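import Literature.NumberTheory.EllipticCurves.Sprung2012.ColemanPairUniqueProofs
import Literature.NumberTheory.EllipticCurves.Sprung2017.SharpFlatPAdicLFunctionUniqueProofs
import Summits.BirchSwinnertonDyer.Rank1Residual.Supersingular.SprungPollackConsistency
import HarnessLib

/-!
# Route `ByReductionTypeAtTwo` (rung K4), crux `SupersingularRankZeroAtTwo` (item stmt-BirchSwinnertonDyer-19097), line
# `odd_blind_package` v2.16, stub 3/6 `stub_flatPackage`, conjunct (8), clause F3 (`G ∈ loc(Z)`, `ι G = C(ϖ)·ι L♭`) — **THE
# COLEMAN–SPRUNG BRIDGE: layer congruences `P_{n,c_n}(z) ≡ ϖ·θ_n (mod ω_n)` + the Mazur–Tate characterisation of `(L♯, L♭)`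
# ⟹ `Col(z) = ϖ·(L♯, L♭)` EXACTLY** (any prime `p ∣ a_p`, any base, any local data; cell `bsd-2adic`, seat `bsd-2adic-tower-1`
# GEN 67, hand H2-F1F3 LANE B, first lemma; `--supports 19097`, helper)

HONEST FRAMING (D-0054): THEOREMS ONLY — no definition, no named fact, no instance, no `sorry`.  Pure `Λ`-algebra; p-generic.

## Why this is the last step of F3

In the tree the ♭ Coleman map and Sprung's ♭ `p`-adic `L`-function are characterised by congruence systems OF THE SAME SHAPE:
* `Sprung2012.IsColemanPair κ ι W a_p g c z L♯' L♭'` ⟺ `∀ n, ω_n ∣ P_{n,c_n}(z) + u_n L♯' + v_n L♭'` in `Λ` (Def. 5.9 / 7.1),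
* `Sprung2017.IsSprungPair f p a_p L♯ L♭` ⟺ `∀ n, θ_n ≡ −(u_n L♯ + v_n L♭) (mod ω_n)` in `Λ ⊗ ℚ_p` (Cor. 4.4–4.5 / Thm. 1.12),
with the same Sprung polynomials `u_n = sharpPoly a_p p n`, `v_n = flatPoly a_p p n` and `θ_n = mazurTateElement f p n`.  Hence an
EXPLICIT RECIPROCITY LAW AT THE LAYERS for a functional `z` (meant: the local image of Kato's zeta class under the `T_pW`-adic layer Tate
pairings) — «`P_{n,c_n}(z) ≡ ϖ·θ_n (mod ω_n)` in `Λ ⊗ ℚ_p` for every `n`» (Kato Thm. 12.5 (1) read on the pairing + the formal logarithms of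
the Honda points + Mazur–Tate interpolation) — forces `Col(z) = ϖ·(L♯, L♭)` ON THE NOSE, by the uniqueness of chromatic limits
(`Sprung2017.IsChromaticLimit.unique`, which needs only `p ∣ a_p` — valid at `p = 2`).  This file proves exactly that implication, with
the rational period ratio `ϖ` (denominators cleared inside the proof), in the shape clause F3b of conjunct (8) consumes
(`iwasawaToPowerSeries p G = PowerSeries.C (ϖ : ℚ_[p]) * iwasawaToPowerSeries p L♭` with `G := Col♭(z) ∈ Λ`).  What it does NOT do: prove
the layer congruences for Kato's class (the explicit reciprocity law at `2` — beyond print; memo `HOME/tower/gen67/F3-ERL-flat-at-2.md`).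
Closes NO stub; 19097 OPEN; nothing booked; BSD is proved for no curve; typed ≠ proved.

## What is proved
* `coe_map_neg_one`, `coe_map_one`, `coe_map_C_intCast_mul` — coercion plumbing `ℤ[T], ℚ[T] → Λ, ℚ_p⟦T⟧`.
* `isCongrModOmega_intCast_mul` — scaling a rational congruence `θ ≡ ω L (mod ω_n)` by an integer.
* `isChromaticLimit_intCast_mul_of_isColemanPair` — `(kL♯', kL♭')` is a chromatic limit of `(k·P_{n,c_n}(z))_n`.
* `isChromaticLimit_num_of_congr_mazurTate` — from `P_{n,c_n}(z) ≡ ϖθ_n` and `IsSprungPair`: `(ϖ.num·L♯, ϖ.num·L♭)` is a chromatic limit of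
  `(ϖ.den·P_{n,c_n}(z))_n` (the integral congruence via `IsCongrModOmega.exists_mul_sub_eq`).
* ★ `iwasawaToPowerSeries_coleman_eq_C_mul_of_congr_mazurTate` — THE BRIDGE: `ι L♯' = C(ϖ)·ι L♯ ∧ ι L♭' = C(ϖ)·ι L♭`.

References: [Sprung2012] F. Sprung, J. Number Theory 132 (2012), Def. 3.1 (p. 1489), Prop. 5.7, Def. 5.9 (p. 1495), Def. 7.1 (p. 1500), Props. 6.3–6.5;
[Sprung2017] F. Sprung, Thm. 1.12, Cor. 4.4–4.5; [Kato2004Asterisque] K. Kato, Astérisque 295 (2004), Thm. 12.5 (1) (pp. 221–222), Thm. 16.6;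
[Kobayashi2003] S. Kobayashi, Invent. Math. 152 (2003), Thm. 6.3, Prop. 8.25; [Pollack2003] R. Pollack, Duke Math. J. 118 (2003), Prop. 6.18.
-/

set_option autoImplicit false
-- the Theorems namespace of this sub repeats the summit name by design (D-0017 nested layout)
set_option linter.dupNamespace false

noncomputable section

open scoped Classical

open Polynomial

universe u

namespace Summit.BirchSwinnertonDyer.BirchSwinnertonDyer.Theorems

namespace SSFlatPackage

open Literature.NumberTheory.EllipticCurves Literature.NumberTheory.EllipticCurves.ZpExtension
  Literature.NumberTheory.EllipticCurves.Sprung2017 Literature.NumberTheory.EllipticCurves.Sprung2012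
  Literature.NumberTheory.EllipticCurves.Kobayashi2003 CongruenceSubgroup

section Algebra

variable {p : ℕ} [hp : Fact p.Prime]

/-- The image of `−1 ∈ ℤ[T]` in `Λ` is `−1`. [folklore] -/
theorem coe_map_neg_one : (((-1 : ℤ[X]).map (Int.castRingHom ℤ_[p]) : ℤ_[p][X]) : PowerSeries ℤ_[p]) = -1 := by
  rw [Polynomial.map_neg, Polynomial.map_one, Polynomial.coe_neg, Polynomial.coe_one]

/-- The image of `1 ∈ ℤ[T]` in `Λ` is `1`. [folklore] -/
theorem coe_map_one : (((1 : ℤ[X]).map (Int.castRingHom ℤ_[p]) : ℤ_[p][X]) : PowerSeries ℤ_[p]) = 1 := by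
  rw [Polynomial.map_one, Polynomial.coe_one]

/-- `(C k · θ)^{ℚ_p} = C k · θ^{ℚ_p}` for an integer `k` (coefficient map then coercion to power series). [folklore] -/
theorem coe_map_C_intCast_mul (k : ℤ) (θ : ℚ[X]) :
    ((Polynomial.map (algebraMap ℚ ℚ_[p]) (Polynomial.C (k : ℚ) * θ) : ℚ_[p][X]) : PowerSeries ℚ_[p]) =
      PowerSeries.C (k : ℚ_[p]) * ((θ.map (algebraMap ℚ ℚ_[p]) : ℚ_[p][X]) : PowerSeries ℚ_[p]) := by
  rw [Polynomial.map_mul, Polynomial.map_C, Polynomial.coe_mul, Polynomial.coe_C, map_intCast (algebraMap ℚ ℚ_[p])]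

/-- **Scaling a rational congruence by an integer**: `θ ≡ ω·L (mod ω_n)` in `Λ ⊗ ℚ_p` implies `kθ ≡ ω·(kL) (mod ω_n)`.
[cite: Pollack2003, Prop. 6.18 (shape of the congruences)] -/
theorem isCongrModOmega_intCast_mul {n : ℕ} {θ : ℚ[X]} {ω : ℤ[X]} {L : IwasawaAlgebra p}
    (h : IsCongrModOmega p n θ ω L) (k : ℤ) :
    IsCongrModOmega p n (Polynomial.C (k : ℚ) * θ) ω (PowerSeries.C (k : ℤ_[p]) * L) := by
  obtain ⟨m, q, e⟩ := h
  refine ⟨m, PowerSeries.C (k : ℤ_[p]) * q, ?_⟩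
  have e1 : iwasawaToPowerSeries p (((ω.map (Int.castRingHom ℤ_[p]) : ℤ_[p][X]) : PowerSeries ℤ_[p]) *
        (PowerSeries.C (k : ℤ_[p]) * L)) =
      PowerSeries.C (k : ℚ_[p]) * iwasawaToPowerSeries p (((ω.map (Int.castRingHom ℤ_[p]) : ℤ_[p][X]) : PowerSeries ℤ_[p]) * L) := by
    rw [mul_left_comm, map_mul (iwasawaToPowerSeries p), PowerSeries.map_C]
    exact congrArg (fun t : ℚ_[p] ↦ PowerSeries.C t * _) (PadicInt.coe_intCast k)
  have e2 : iwasawaToPowerSeries p ((((cyclotomicOmega p n).map (Int.castRingHom ℤ_[p]) : ℤ_[p][X]) : PowerSeries ℤ_[p]) *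
        (PowerSeries.C (k : ℤ_[p]) * q)) =
      PowerSeries.C (k : ℚ_[p]) *
        iwasawaToPowerSeries p ((((cyclotomicOmega p n).map (Int.castRingHom ℤ_[p]) : ℤ_[p][X]) : PowerSeries ℤ_[p]) * q) := by
    rw [mul_left_comm, map_mul (iwasawaToPowerSeries p), PowerSeries.map_C]
    exact congrArg (fun t : ℚ_[p] ↦ PowerSeries.C t * _) (PadicInt.coe_intCast k)
  rw [coe_map_C_intCast_mul, e1, e2, ← e]
  ring

end Algebra

section Bridge

variable {K : Type u} [Field K] {p : ℕ} [hp : Fact p.Prime] (κ : ZpExtension K p)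
variable {E : Type u} [Field E] [Algebra K E] (ι : AlgebraicClosure K →ₐ[K] AlgebraicClosure E)
variable (W : WeierstrassCurve K)

/-- **An integer multiple of a Coleman value is a chromatic limit of the scaled layer values**: if `(L♯', L♭')` is a Coleman value
of `z` (`ω_n ∣ P_{n,c_n}(z) + u_n L♯' + v_n L♭'`), then `(k L♯', k L♭')` is a chromatic limit of `(k·Θ_n)_n`, `Θ_n` the polynomial
lift of `P_{n,c_n}(z)` (`Sprung2012.colemanTheta`). [cite: Sprung2012, Def. 5.9 (p. 1495)] [cite: Sprung2017, Cor. 4.4] -/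
theorem isChromaticLimit_intCast_mul_of_isColemanPair {ap : ℤ} {g : Field.absoluteGaloisGroup E}
    {c : ℕ → localPoints W E} {z : localTowerPointsOfEmb κ ι W →+ ℤ_[p]} {Lsharp Lflat : IwasawaAlgebra p}
    (h : IsColemanPair κ ι W ap g c z Lsharp Lflat) (k : ℤ) :
    IsChromaticLimit p ap (fun n ↦ Polynomial.C (k : ℤ_[p]) * colemanTheta κ ι W g c z n)
      (PowerSeries.C (k : ℤ_[p]) * Lsharp) (PowerSeries.C (k : ℤ_[p]) * Lflat) := by
  intro n
  obtain ⟨Q, hQ⟩ := h n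
  rw [Summit.BirchSwinnertonDyer.Rank1Residual.Supersingular.toIwasawa_apply (cyclotomicOmega p n)] at hQ
  refine ⟨PowerSeries.C (k : ℤ_[p]) * Q, ?_⟩
  have hΘ : ((Polynomial.C (k : ℤ_[p]) * colemanTheta κ ι W g c z n : ℤ_[p][X]) : PowerSeries ℤ_[p]) =
      PowerSeries.C (k : ℤ_[p]) * pairingSum W (localTowerPointsOfEmb κ ι W) g n (c n) z := by
    rw [Polynomial.coe_mul, Polynomial.coe_C, coe_colemanTheta]
  rw [hΘ]
  linear_combination (PowerSeries.C (k : ℤ_[p])) * hQ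

/-- **The integral congruence behind F3** (Step 1 of the bridge).  If `P_{n,c_n}(z) ≡ ϖ·θ_n (mod ω_n)` in `Λ ⊗ ℚ_p` for every `n`
(`IsCongrModOmega p n (C ϖ · θ_n) 1 (P_{n,c_n}(z))`) and `(L♯, L♭)` is a Sprung pair for `f` at `p` (`θ_n ≡ −(u_n L♯ + v_n L♭)`), then —
writing `ϖ = ϖ.num / ϖ.den` — the INTEGRAL pair `(ϖ.num·L♯, ϖ.num·L♭)` is a chromatic limit of the integral sequence
`(ϖ.den·Θ_n)_n`: the two rational congruences for `ϖ.num·θ_n` have an integral difference (`IsCongrModOmega.exists_mul_sub_eq`: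
`ω_n` is distinguished, so `p`-power denominators cancel). [cite: Sprung2017, Thm. 1.12 (uniqueness, Step 1) and Cor. 4.4]
[cite: Pollack2003, Prop. 6.18] -/
theorem isChromaticLimit_num_of_congr_mazurTate {ap : ℤ} {g : Field.absoluteGaloisGroup E}
    {c : ℕ → localPoints W E} {z : localTowerPointsOfEmb κ ι W →+ ℤ_[p]}
    {N : ℕ} (f : CuspForm (Gamma0 N) 2) {Lsharp Lflat : IwasawaAlgebra p} (hL : IsSprungPair f p ap Lsharp Lflat)
    (ϖ : ℚ)
    (hPS : ∀ n : ℕ, IsCongrModOmega p n (Polynomial.C ϖ * mazurTateElement f p n) 1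
      (pairingSum W (localTowerPointsOfEmb κ ι W) g n (c n) z)) :
    IsChromaticLimit p ap (fun n ↦ Polynomial.C ((ϖ.den : ℤ) : ℤ_[p]) * colemanTheta κ ι W g c z n)
      (PowerSeries.C (ϖ.num : ℤ_[p]) * Lsharp) (PowerSeries.C (ϖ.num : ℤ_[p]) * Lflat) := by
  intro n
  set u : IwasawaAlgebra p := toIwasawa p (sharpPoly ap p n) with hu_def
  set v : IwasawaAlgebra p := toIwasawa p (flatPoly ap p n) with hv_def
  set PS : IwasawaAlgebra p := pairingSum W (localTowerPointsOfEmb κ ι W) g n (c n) z with hPS_def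
  set Ω : IwasawaAlgebra p := ((cyclotomicOmega p n).map (Int.castRingHom ℤ_[p]) : PowerSeries ℤ_[p]) with hΩ_def
  -- (i) `ϖ.num·θ_n ≡ −(u (ϖ.num L♯) + v (ϖ.num L♭))`
  have h1 : IsCongrModOmega p n (Polynomial.C ((ϖ.num : ℤ) : ℚ) * mazurTateElement f p n) (-1)
      (PowerSeries.C (ϖ.num : ℤ_[p]) * (u * Lsharp + v * Lflat)) :=
    isCongrModOmega_intCast_mul (hL n) ϖ.num
  -- (ii) `ϖ.num·θ_n = ϖ.den·(ϖθ_n) ≡ ϖ.den·P_{n,c_n}(z) = −(−ϖ.den·PS)`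
  have h2 : IsCongrModOmega p n (Polynomial.C ((ϖ.num : ℤ) : ℚ) * mazurTateElement f p n) (-1)
      (-(PowerSeries.C ((ϖ.den : ℤ) : ℤ_[p]) * PS)) := by
    have h2' := isCongrModOmega_intCast_mul (hPS n) (ϖ.den : ℤ)
    obtain ⟨m, q, e⟩ := h2'
    refine ⟨m, q, ?_⟩
    have hnum : Polynomial.C ((ϖ.den : ℤ) : ℚ) * (Polynomial.C ϖ * mazurTateElement f p n) =
        Polynomial.C ((ϖ.num : ℤ) : ℚ) * mazurTateElement f p n := by
      rw [← mul_assoc, ← Polynomial.C_mul, Int.cast_natCast, mul_comm ((ϖ.den : ℚ)) ϖ, Rat.mul_den_eq_num]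
    rw [hnum, coe_map_one, one_mul] at e
    rw [coe_map_neg_one, neg_one_mul, neg_neg]
    exact e
  obtain ⟨r, hr⟩ := h1.exists_mul_sub_eq h2
  rw [coe_map_neg_one] at hr
  refine ⟨-r, ?_⟩
  have hΘ : ((Polynomial.C ((ϖ.den : ℤ) : ℤ_[p]) * colemanTheta κ ι W g c z n : ℤ_[p][X]) : PowerSeries ℤ_[p]) =
      PowerSeries.C ((ϖ.den : ℤ) : ℤ_[p]) * PS := by
    rw [Polynomial.coe_mul, Polynomial.coe_C, coe_colemanTheta]
  rw [hΘ]
  linear_combination -hr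

/-- ★ **THE COLEMAN–SPRUNG BRIDGE (F3, last step; any prime `p ∣ a_p`, any base field, any local data).**  Let `z` be a functional on
`E(K_∞·K_v)` with Coleman value `(L♯', L♭')` for the data `(a_p, g, c)` (`Sprung2012.IsColemanPair`), let `(L♯, L♭)` be a Sprung pair for
the newform `f` at `p` (`Sprung2017.IsSprungPair`: the Mazur–Tate congruences), and suppose the LAYER RECIPROCITY LAW
`P_{n,c_n}(z) ≡ ϖ·θ_n (mod ω_n)` in `Λ ⊗ ℚ_p` holds for every `n` with a rational constant `ϖ`.  THEN `ι L♯' = C(ϖ)·ι L♯` and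
`ι L♭' = C(ϖ)·ι L♭` in `ℚ_p⟦T⟧` — i.e. `Col(z) = ϖ·(L♯, L♭)` exactly (in particular `ϖ·L♭ ∈ Λ`).  Proof: both `(ϖ.den·L♯', ϖ.den·L♭')`
and `(ϖ.num·L♯, ϖ.num·L♭)` are chromatic limits of `(ϖ.den·P_{n,c_n}(z))_n`, hence equal (`IsChromaticLimit.unique`, `p ∣ a_p`); divide
by `ϖ.den` in `ℚ_p⟦T⟧`.  The conclusion is VERBATIM the shape of clause F3b of conjunct (8) of `FlatPackageAtTwo` with `G := L♭'`.
[cite: Sprung2012, Prop. 5.7, Def. 5.9 (p. 1495), Def. 7.1 (p. 1500)] [cite: Sprung2017, Thm. 1.12 and Cor. 4.4–4.5]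
[cite: Kato2004Asterisque, Thm. 12.5 (1) (pp. 221–222) and Thm. 16.6] [cite: Kobayashi2003, Thm. 6.3 and Prop. 8.25] -/
theorem iwasawaToPowerSeries_coleman_eq_C_mul_of_congr_mazurTate {ap : ℤ} (hap : (p : ℤ) ∣ ap)
    {g : Field.absoluteGaloisGroup E} {c : ℕ → localPoints W E} {z : localTowerPointsOfEmb κ ι W →+ ℤ_[p]}
    {Lsharp' Lflat' : IwasawaAlgebra p} (hz : IsColemanPair κ ι W ap g c z Lsharp' Lflat')
    {N : ℕ} (f : CuspForm (Gamma0 N) 2) {Lsharp Lflat : IwasawaAlgebra p} (hL : IsSprungPair f p ap Lsharp Lflat)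
    (ϖ : ℚ)
    (hPS : ∀ n : ℕ, IsCongrModOmega p n (Polynomial.C ϖ * mazurTateElement f p n) 1
      (pairingSum W (localTowerPointsOfEmb κ ι W) g n (c n) z)) :
    iwasawaToPowerSeries p Lsharp' = PowerSeries.C (ϖ : ℚ_[p]) * iwasawaToPowerSeries p Lsharp ∧
      iwasawaToPowerSeries p Lflat' = PowerSeries.C (ϖ : ℚ_[p]) * iwasawaToPowerSeries p Lflat := by
  have hA := isChromaticLimit_intCast_mul_of_isColemanPair κ ι W hz (ϖ.den : ℤ)
  have hB := isChromaticLimit_num_of_congr_mazurTate κ ι W f hL ϖ hPS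
  obtain ⟨hs, hf⟩ := IsChromaticLimit.unique hap hA hB
  have hden : (PowerSeries.C ((ϖ.den : ℤ) : ℚ_[p]) : PowerSeries ℚ_[p]) * PowerSeries.C (((ϖ.den : ℤ) : ℚ_[p])⁻¹) = 1 := by
    rw [← map_mul, mul_inv_cancel₀ (by exact_mod_cast ϖ.den_ne_zero), map_one]
  have hϖ : (PowerSeries.C (((ϖ.den : ℤ) : ℚ_[p])⁻¹) : PowerSeries ℚ_[p]) * PowerSeries.C ((ϖ.num : ℤ) : ℚ_[p]) =
      PowerSeries.C (ϖ : ℚ_[p]) := by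
    rw [← map_mul]
    congr 1
    rw [Int.cast_natCast, Rat.cast_def, div_eq_inv_mul]
  have key : ∀ {L' L : IwasawaAlgebra p},
      PowerSeries.C ((ϖ.den : ℤ) : ℤ_[p]) * L' = PowerSeries.C (ϖ.num : ℤ_[p]) * L →
      iwasawaToPowerSeries p L' = PowerSeries.C (ϖ : ℚ_[p]) * iwasawaToPowerSeries p L := by
    intro L' L h
    have h' := congrArg (iwasawaToPowerSeries p) h
    rw [map_mul, map_mul, PowerSeries.map_C, PowerSeries.map_C] at h'
    change PowerSeries.C (((ϖ.den : ℤ) : ℤ_[p]) : ℚ_[p]) * iwasawaToPowerSeries p L' =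
      PowerSeries.C ((ϖ.num : ℤ_[p]) : ℚ_[p]) * iwasawaToPowerSeries p L at h'
    rw [PadicInt.coe_intCast, PadicInt.coe_intCast] at h'
    calc iwasawaToPowerSeries p L'
        = PowerSeries.C (((ϖ.den : ℤ) : ℚ_[p])⁻¹) * (PowerSeries.C ((ϖ.den : ℤ) : ℚ_[p]) * iwasawaToPowerSeries p L') := by
          rw [← mul_assoc, mul_comm (PowerSeries.C _) (PowerSeries.C _), hden, one_mul]
      _ = PowerSeries.C (ϖ : ℚ_[p]) * iwasawaToPowerSeries p L := by rw [h', ← mul_assoc, hϖ]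
  exact ⟨key hs, key hf⟩

end Bridge

end SSFlatPackage

end Summit.BirchSwinnertonDyer.BirchSwinnertonDyer.Theorems

end
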